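import Mathlib
import Summits.Ventures.PercRepro2.CrossAPrimeA2VEdge

/-!
# The admissibility bound for explored-edge events
(blind cell PercRepro2, p5 g38; `proofs/subclaims/S4-HARDSTEP.md` §2.4 (s) addendum 46 (3))

`prob_Q_vL_le_mul` (`CrossAPrimeA2VEdge`) bounds `P(C(a₂) ∈ 𝓤, a₁ ↔ v, Q) ≤ c · P(C(a₂) ∈ 𝓤, Q)`
for every family `𝓤` of clusters and every admissible constant `c` (`Adm`).  This file extends
the bound from cluster families to every event determined by the EXPLORATION of `C(a₂)`: an
event `A` such that two configurations with the same cluster of `a₂` which agree on the edges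
touching that cluster agree on `A` (**`ExploredEvent`**).  The tool is the tower identity with the
statistic `ω ↦ ω|_{touches C(a₂)}` (the configuration restricted to the explored edges — it
determines the cluster, `cluster_restrict_touches`):

* **`prob_explored_inter_avoid_eq_expect`**: for `t ∈ X`,
  `P(A, C_t ∈ 𝓥, s ↮ X) = E[1_A · g_𝓥(C_s) · 1_{s ↮ X}]` with `g_𝓥 = delClusterProb`;
* **`prob_Q_vL_le_mul_explored`**: `P(A, a₁ ↔ v, Q) ≤ c · P(A, Q)` for every explored event `A`
  of `a₂` and every admissible `c`.

Explored events are closed under intersection (`exploredEvent_inter`); `Q = {a₂ ↮ a₁}` is one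
(`exploredEvent_avoidAll`), and so is the event needed by the `a₂`-side induction along a coin
`e = {a₂, o}`: «`o` is not in the cluster of `a₂` once `e` is closed»
(`exploredEvent_notMem_cluster_update`) — the type-2 configurations of the coin-at-a-mark split.
Own work; standard axioms.
-/

namespace Summit.Ventures.PercRepro2

open CrossAPrimeA2Induction

namespace CrossAPrimeExploredBound

section Explored

variable {V : Type*} {E : Type*} {ends : E → Sym2 V}

/-- **Explored events of `s`**: two configurations with the same cluster of `s` that agree on the
edges touching it agree on `A`. -/
def ExploredEvent (ends : E → Sym2 V) (s : V) (A : Set (Config E)) : Prop :=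
  ∀ ω ω' : Config E, cluster ends ω s = cluster ends ω' s →
    (∀ e ∈ touches ends (cluster ends ω s), ω e = ω' e) → (ω ∈ A ↔ ω' ∈ A)

/-- Explored events are closed under intersection. -/
lemma exploredEvent_inter {s : V} {A B : Set (Config E)} (hA : ExploredEvent ends s A)
    (hB : ExploredEvent ends s B) : ExploredEvent ends s (A ∩ B) := by
  intro ω ω' hc h
  rw [Set.mem_inter_iff, Set.mem_inter_iff, hA ω ω' hc h, hB ω ω' hc h]

/-- `{s ↮ X}` is an explored event of `s`. -/
lemma exploredEvent_avoidAll (s : V) (X : Finset V) :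
    ExploredEvent ends s (avoidAll ends s X) := by
  intro ω ω' hc _
  simp only [mem_avoidAll]
  constructor
  · intro h x hx hcx
    refine h x hx ?_
    have hmem : x ∈ cluster ends ω' s := hcx
    rw [← hc] at hmem
    exact hmem
  · intro h x hx hcx
    refine h x hx ?_
    have hmem : x ∈ cluster ends ω s := hcx
    rw [hc] at hmem
    exact hmem

variable [DecidableEq E]

/-- Closing an edge lowers the configuration. -/
lemma update_false_le (ω : Config E) (e : E) : Function.update ω e false ≤ ω := by
  intro g
  by_cases hg : g = e
  · subst hg
    rw [Function.update_self]
    exact Bool.false_le _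
  · rw [Function.update_of_ne hg]

/-- «`x` is not in the cluster of `s` once the edge `e` is closed» is an explored event of `s`:
the cluster with `e` closed is contained in the cluster, hence determined by the explored edges. -/
lemma exploredEvent_notMem_cluster_update (s x : V) (e : E) :
    ExploredEvent ends s {ω | x ∉ cluster ends (Function.update ω e false) s} := by
  intro ω ω' hc h
  simp only [Set.mem_setOf_eq]
  have hsub : cluster ends (Function.update ω e false) s ⊆ cluster ends ω s :=
    cluster_mono (update_false_le ω e) s
  have key : cluster ends (Function.update ω' e false) s =
      cluster ends (Function.update ω e false) s := by
    refine cluster_eq_of_eqOn_touches (ω := Function.update ω e false) ?_ rfl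
    intro f hf
    have hf' : f ∈ touches ends (cluster ends ω s) := touches_mono hsub hf
    by_cases hfe : f = e
    · subst hfe
      simp only [Function.update_self]
    · rw [Function.update_of_ne hfe, Function.update_of_ne hfe]
      exact h f hf'
  rw [key]

end Explored

section Tower

variable {V : Type*} {E : Type*} [Fintype E] [DecidableEq E] [Fintype V] [DecidableEq V]
  {R : Type*} [CommRing R]
variable {ends : E → Sym2 V}

omit [Fintype E] [DecidableEq E] [Fintype V] [DecidableEq V] in
/-- The configuration restricted to the explored edges has the same cluster of `s`. -/
lemma cluster_restrict_touches (ω : Config E) (s : V)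
    [DecidablePred (· ∈ touches ends (cluster ends ω s))] :
    cluster ends (restrict (touches ends (cluster ends ω s)) ω) s = cluster ends ω s :=
  cluster_eq_of_eqOn_touches (fun _ he => (restrict_apply_of_mem he).symm) rfl

omit [DecidableEq V] in
/-- **Exploring the cluster of `s` under set avoidance, for an explored event**: for `t ∈ X`,
`P(A, C_t ∈ 𝓥, s ↮ X) = E[1_A · g_𝓥(C_s) · 1_{s↮X}]` with `g_𝓥 = delClusterProb`. -/
theorem prob_explored_inter_avoid_eq_expect (p : E → R) (ends : E → Sym2 V) (s t : V)
    {X : Finset V} (ht : t ∈ X) {A : Set (Config E)} (hA : ExploredEvent ends s A)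
    (𝓥 : Set (Set V)) :
    prob p (A ∩ clusterInEvent ends t 𝓥 ∩ avoidAll ends s X) =
      expect p (fun ω => A.indicator 1 ω * delClusterProb p ends t 𝓥 (cluster ends ω s) *
        (avoidAll ends s X).indicator 1 ω) := by
  classical
  -- `𝓐 = {W | W ∩ X = ∅}` describes `{s ↮ X}` through the cluster of `s`
  let 𝓐 : Set (Set V) := {W | ∀ x ∈ X, x ∉ W}
  have h𝓐 : ∀ ω, ω ∈ avoidAll ends s X ↔ cluster ends ω s ∈ 𝓐 := fun ω => Iff.rfl
  -- the statistic: the configuration restricted to the edges touching the cluster of `s`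
  let S : Config E → Config E := fun ω => restrict (touches ends (cluster ends ω s)) ω
  let F₁ : Config E → Set E := fun σ => touches ends (cluster ends σ s)
  let F₂ : Config E → Set E := fun σ => (touches ends (cluster ends σ s))ᶜ
  let c : Config E → R := fun σ => A.indicator 1 σ * 𝓐.indicator 1 (cluster ends σ s)
  let D : Set V → Config E → R := fun W =>
    ({ω | cluster ends (delConfig ends W ω) t ∈ 𝓥} : Set (Config E)).indicator 1
  let Φ : Config E → Config E → R := fun σ ω => c σ * D (cluster ends σ s) ω
  have hSc : ∀ ω, cluster ends (S ω) s = cluster ends ω s := fun ω => cluster_restrict_touches ω s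
  have hSa : ∀ ω, (ω ∈ A ↔ S ω ∈ A) := fun ω =>
    hA ω (S ω) (hSc ω).symm (fun e he => (restrict_apply_of_mem he).symm)
  have hΦ : ∀ σ, DependsOn (Φ σ) (F₂ σ) := by
    intro σ ω ω' h
    simp only [Φ, D]
    congr 1
    refine dependsOn_indicator (R := R) (fun ω ω' h => ?_) h
    show (cluster ends (delConfig ends (cluster ends σ s) ω) t ∈ 𝓥) =
      (cluster ends (delConfig ends (cluster ends σ s) ω') t ∈ 𝓥)
    rw [delConfig_congr h]
  have hS : ∀ σ, DependsOn (· ∈ {ω | S ω = σ}) (F₁ σ) := by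
    intro σ ω ω' h
    show (S ω = σ) = (S ω' = σ)
    apply propext
    constructor
    · intro hσ
      have hc : cluster ends ω s = cluster ends σ s := by rw [← hσ, hSc]
      have hc' : cluster ends ω' s = cluster ends σ s :=
        cluster_eq_of_eqOn_touches h hc
      show restrict (touches ends (cluster ends ω' s)) ω' = σ
      rw [hc', ← hc]
      have hr : restrict (touches ends (cluster ends ω s)) ω' =
          restrict (touches ends (cluster ends ω s)) ω :=
        restrict_congr fun e he =>
          (h e (by show e ∈ touches ends (cluster ends σ s); rw [← hc]; exact he)).symm
      rw [hr]
      exact hσ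
    · intro hσ
      have hc' : cluster ends ω' s = cluster ends σ s := by rw [← hσ, hSc]
      have hc : cluster ends ω s = cluster ends σ s :=
        cluster_eq_of_eqOn_touches (fun e he => (h e he).symm) hc'
      show restrict (touches ends (cluster ends ω s)) ω = σ
      rw [hc, ← hc']
      have hr : restrict (touches ends (cluster ends ω' s)) ω =
          restrict (touches ends (cluster ends ω' s)) ω' :=
        restrict_congr fun e he =>
          h e (by show e ∈ touches ends (cluster ends σ s); rw [← hc']; exact he)
      rw [hr]
      exact hσ
  have hdisj : ∀ σ, Disjoint (F₁ σ) (F₂ σ) := fun σ => disjoint_compl_right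
  have hpt : ∀ ω, (A ∩ clusterInEvent ends t 𝓥 ∩ avoidAll ends s X).indicator
      (1 : Config E → R) ω = Φ (S ω) ω := by
    intro ω
    simp only [Φ, c, D]
    rw [hSc ω]
    by_cases hav : ω ∈ avoidAll ends s X
    · have hst : t ∉ cluster ends ω s := notMem_cluster_of_mem_avoidAll ht hav
      have e := cluster_delConfig_cluster (ends := ends) (ω := ω) (s := s) hst
      have hmem : ω ∈ {ω' | cluster ends (delConfig ends (cluster ends ω s) ω') t ∈ 𝓥} ↔
          cluster ends ω t ∈ 𝓥 := by
        rw [Set.mem_setOf_eq, e]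
      rw [Set.indicator_of_mem (show cluster ends ω s ∈ 𝓐 from (h𝓐 ω).1 hav)]
      by_cases hAω : ω ∈ A
      · rw [Set.indicator_of_mem ((hSa ω).1 hAω)]
        by_cases h𝓥 : cluster ends ω t ∈ 𝓥
        · rw [Set.indicator_of_mem (show ω ∈ A ∩ clusterInEvent ends t 𝓥 ∩
              avoidAll ends s X from ⟨⟨hAω, h𝓥⟩, hav⟩), Set.indicator_of_mem (hmem.2 h𝓥)]
          simp
        · rw [Set.indicator_of_notMem (show ω ∉ A ∩ clusterInEvent ends t 𝓥 ∩
              avoidAll ends s X from fun h => h𝓥 h.1.2),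
            Set.indicator_of_notMem (fun h => h𝓥 (hmem.1 h))]
          simp
      · rw [Set.indicator_of_notMem (show ω ∉ A ∩ clusterInEvent ends t 𝓥 ∩
            avoidAll ends s X from fun h => hAω h.1.1),
          Set.indicator_of_notMem (fun h => hAω ((hSa ω).2 h))]
        simp
    · rw [Set.indicator_of_notMem (show ω ∉ A ∩ clusterInEvent ends t 𝓥 ∩
          avoidAll ends s X from fun h => hav h.2),
        Set.indicator_of_notMem (show cluster ends ω s ∉ 𝓐 from fun h => hav ((h𝓐 ω).2 h))]
      simp
  have hΦexp : ∀ σ, expect p (Φ σ) = c σ * delClusterProb p ends t 𝓥 (cluster ends σ s) := by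
    intro σ
    simp only [Φ, D]
    rw [expect_const_mul, ← prob_eq_expect_indicator]
    rfl
  rw [prob_eq_expect_indicator]
  have e1 : (A ∩ clusterInEvent ends t 𝓥 ∩ avoidAll ends s X).indicator (1 : Config E → R) =
      fun ω => Φ (S ω) ω :=
    funext hpt
  rw [e1, expect_tower p hdisj (S := S) hS hΦ]
  simp only [hΦexp]
  unfold expect
  refine Finset.sum_congr rfl fun ω _ => ?_
  simp only [c]
  rw [hSc ω]
  have hAind : A.indicator (1 : Config E → R) (S ω) = A.indicator 1 ω := by
    by_cases hAω : ω ∈ A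
    · rw [Set.indicator_of_mem hAω, Set.indicator_of_mem ((hSa ω).1 hAω)]
      simp only [Pi.one_apply]
    · rw [Set.indicator_of_notMem hAω, Set.indicator_of_notMem (fun h => hAω ((hSa ω).2 h))]
  rw [hAind]
  by_cases hav : ω ∈ avoidAll ends s X
  · rw [Set.indicator_of_mem (show cluster ends ω s ∈ 𝓐 from (h𝓐 ω).1 hav),
      Set.indicator_of_mem hav]
    simp
  · rw [Set.indicator_of_notMem (show cluster ends ω s ∉ 𝓐 from fun h => hav ((h𝓐 ω).2 h)),
      Set.indicator_of_notMem hav]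
    simp

end Tower

section Bound

variable {V : Type*} {E : Type*} [Fintype E] [DecidableEq E] [Fintype V] [DecidableEq V]
  {R : Type*} [Field R] [LinearOrder R] [IsStrictOrderedRing R]
variable {ends : E → Sym2 V}

omit [DecidableEq V] in
/-- **The admissibility bound for explored events**: under an admissible `c`, for every explored
event `A` of `a₂`, `P(A, a₁ ↔ v, Q) ≤ c · P(A, Q)`. -/
theorem prob_Q_vL_le_mul_explored {p : E → R} (hp : IsProbVec p) {c : R} {a₁ a₂ v : V}
    (hadm : Adm p c ends a₁ a₂ v) {A : Set (Config E)} (hA : ExploredEvent ends a₂ A) :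
    prob p (A ∩ connEvent ends a₁ v ∩ avoidAll ends a₂ {a₁}) ≤
      c * prob p (A ∩ avoidAll ends a₂ {a₁}) := by
  classical
  rw [CrossAPrimeA2VEdge.connEvent_eq_clusterInEvent_v a₁ v,
    prob_explored_inter_avoid_eq_expect p ends a₂ a₁ (Finset.mem_singleton_self a₁) hA
      {B : Set V | v ∈ B},
    prob_eq_expect_indicator, ← expect_const_mul]
  refine CrossAPrimeA2VEdge.expect_mono_supp hp fun ω hω => ?_
  rw [indicator_inter_one]
  by_cases hQ : ω ∈ avoidAll ends a₂ {a₁}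
  · have hg : delClusterProb p ends a₁ {B : Set V | v ∈ B} (cluster ends ω a₂) ≤ c := by
      have h1 : a₁ ∉ cluster ends ω a₂ := by
        rw [mem_avoidAll] at hQ
        exact fun h => hQ a₁ (Finset.mem_singleton_self a₁) h
      have := hadm (cluster ends ω a₂) (CrossAPrimeA2VEdge.sure_cluster_subset hω a₂) h1
      unfold delClusterProb
      refine le_trans (le_of_eq ?_) this
      rfl
    have hU : 0 ≤ A.indicator (1 : Config E → R) ω :=
      Set.indicator_apply_nonneg fun _ => zero_le_one
    rw [Set.indicator_of_mem hQ]
    simp only [Pi.one_apply, mul_one]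
    calc A.indicator 1 ω * delClusterProb p ends a₁ {B : Set V | v ∈ B} (cluster ends ω a₂)
        ≤ A.indicator 1 ω * c := mul_le_mul_of_nonneg_left hg hU
      _ = c * A.indicator 1 ω := mul_comm _ _
  · rw [Set.indicator_of_notMem hQ]
    simp

end Bound

end CrossAPrimeExploredBound

end Summit.Ventures.PercRepro2
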